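/-
Copyright (c) 2026. All rights reserved.
Released under Apache 2.0 license as described in the file LICENSE.
-/
import Literature.NumberTheory.ComplexMultiplication.DegenerateCMTypesElementaryAbelianRankFive
import HarnessLib

/-!
# Census of the CM types of Kubota rank `5` on an elementary abelian `2`-group: `2·C(|G|/2, 3)`

SETTING (tree `CMTypeRankCharacters`, T. Kubota [Kubota1965] §4 Lemma 2 = B. B. Gordon [Gordon1999HodgeAVSurvey]
Prop. 9.4.1).  `G` a finite commutative group of exponent `2` — the Galois group of a multiquadratic CM field —
`ρ ∈ G`, `ρ ≠ 1` (complex conjugation), `T ⊆ G` a CM type (`IsCMTypeWith ρ T`: `T ⊔ ρT = G`), characters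
`χ : AddChar (Additive G) ℂ` (`±1`-valued; ODD when `χ(ρ) = −1`), `Ŝ(χ) = Σ_{t ∈ T} χ(t)`,
`rank(T) = 1 + #{χ odd : Ŝ(χ) ≠ 0}` (Kubota; the odd `χ` with `Ŝ(χ) ≠ 0` are the SURVIVORS).  The tree classifies
the types of rank `5` (`DegenerateCMTypesElementaryAbelianRankFive`, `typeRank_eq_five_iff_exists_majority_translate`):
they are exactly the TRANSLATES `Maj(χ₁, χ₂, χ₃)·u` of the majority types of three distinct odd characters, with
survivors `χ₁, χ₂, χ₃, χ₁χ₂χ₃` and stabiliser the joint kernel `ker χ₁ ∩ ker χ₂ ∩ ker χ₃` of index `8`.  THIS FILE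
counts them:

> **Theorem** (`card_filter_typeRank_eq_five`).  On a finite commutative group `G` of exponent `2`, w.r.t. any
> `ρ ≠ 1`, **the number of CM types of Kubota rank `5` is `2·C(|G|/2, 3)`**; on `(ℤ/2)^{n+1}` this is `2·C(2ⁿ, 3)`
> of the `2^{2ⁿ}` CM types (`card_filter_typeRank_eq_five_of_card_eq_two_pow`): `8` of `16` in order `8`, `112` of
> `256` in order `16`, `1120` of `65536` in order `32` (`…_of_card_eq_eight / sixteen / thirtyTwo`).

On the field side (dictionary `CyclicTwoOddPrimes.isCMTypeWith_galType`, `cmTypeRank_eq_typeRank_galType`,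
`CyclicPrimeSquare.ncard_cmType_sep_eq`, not restated here): a multiquadratic CM field of degree `2^{n+1}` has exactly
`2·C(2ⁿ, 3)` CM types of rank `5` — the types induced from the nondegenerate types of its octic CM subfields.

PROOF (fibre count).  The map `((χ₁, χ₂, χ₃), u) ↦ Maj(χ₁, χ₂, χ₃)·u = {x : Maj(ux)}` from
(ordered triples of distinct odd characters) `× G` — a set of `m(m−1)(m−2)·|G|` elements, `m = |G|/2` the number
of odd characters — lands in the rank-`5` types (§3, §6) and is onto them (the classification).  Its fibre over a
rank-`5` type `T` with survivor quadruple `Q = {χ₁, χ₂, χ₃, χ₁χ₂χ₃}` consists of the `24` ordered triples of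
distinct members of `Q` (§4: any three distinct members `a, b, c` of a `4`-set `Q` of characters with `Σ_Q χ = 0`
have `{a, b, c, abc} = Q`; a triple spanning another quadruple translates onto types with other survivors, §3),
each paired with the `|G|/8` elements of a coset of the joint kernel (§3, §5); so every fibre has `24·|G|/8 = 3|G|`
elements and `#{rank 5} = m(m−1)(m−2)/3 = 2·C(m, 3)`.

* §1 (private counting helpers) `|Q|(|Q|−1)(|Q|−2)` ordered triples of distinct members of a finite set `Q`.
* §2 helpers: translates read through a predicate (private plumbing; public: `sum_char_eq_of_mem_iff`,
  `filter_sum_ne_zero_eq_of_mem_iff` — a translate has the same survivors).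
* §3 **`isCMTypeWith_of_majority_translate`**, **`filter_survivors_eq_of_majority_translate`** (a translate of
  `Maj(χ₁, χ₂, χ₃)` is a CM type with survivors `χ₁, χ₂, χ₃, χ₁χ₂χ₃`), `forall_majority_mul_iff_iff`,
  **`eight_mul_card_filter_translating_eq`** (`|G|/8` translating elements).
* §4 (private) the survivor quadruples: three distinct members `a, b, c` of a `4`-set `Q` of characters with
  `Σ_Q χ = 0` have `{a, b, c, abc} = Q`; each quadruple is spanned by exactly `24` ordered triples.
* §5 `eight_mul_card_filter_translate_eq_of_survivors_eq`, `card_filter_translate_eq_zero_of_survivors_ne`,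
  **`card_fibre_eq`** (`3|G|`).
* §6 `translate_mem_filter_typeRank_eq_five`, **`card_filter_typeRank_eq_five`**,
  `card_filter_typeRank_eq_five_of_card_eq_two_pow`, `…_of_card_eq_eight`, `…_of_card_eq_sixteen`,
  `…_of_card_eq_thirtyTwo`.

HONEST SCOPE.  Elementary counting on the tree's classification of the rank-`5` types; the sources print Kubota's
formula (Kubota, Gordon), the induced-type dictionary (Kubota §2, Shimura §8.4), Dodson's weight/inversion method and
the structure of Boolean functions with a flat Walsh support of size `4` (Carlet); the NUMBER `2·C(|G|/2, 3)` is this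
file's count, not a printed statement of the sources.  THEOREMS ONLY: no definition, no named fact, no instance, no
`sorry`.

## References

* [Kubota1965] T. Kubota, *On the field extension by complex multiplication*, Trans. AMS 118 (1965), §2 (induced
  types), §4 Lemma 2 (the rank formula).
* [Gordon1999HodgeAVSurvey] B. B. Gordon, *A survey of the Hodge conjecture for abelian varieties*, §9.4.1
  (Proposition [B.60]), §9.4.2.
* [Dodson1984] B. Dodson, *The structure of Galois groups of CM-fields*, Trans. AMS 283 (1984), §3.1.1 (Theorem:
  the weight/inversion method for fields of type `(2, …, 2)`).
* [Carlet2020] C. Carlet, *Boolean Functions for Cryptography and Coding Theory* (2020), §6.2 Prop. 94, Def. 62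
  (partially-bent functions), Ch. 9 (majority function).
* [Shimura1998] G. Shimura, *Abelian Varieties with Complex Multiplication and Modular Functions*, §8.4 Example (1).

## Provenance

Lane `lit-hodgefound` (Track 2, Layer A3/A4), seat `lit-hodgefound-p10` generation 40, row g40-#10 (successor menu
(c) of generation 39); neighbours cited by name, nothing restated: `DegenerateCMTypesElementaryAbelianRankFive`
(`exists_majority_translate_of_typeRank_eq_five`, `typeRank_eq_five_of_majority_translate`,
`AbelianTranslate.isCMTypeWith_image_mul`), `DegenerateCMTypesElementaryAbelianMajorityType`
(`isCMTypeWith_of_majority`, `survivors_eq_of_majority`, `forall_mul_mem_iff_iff_of_majority`,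
`eight_mul_card_filter_eq_eq_eq_of_odd`, `add_self_eq_zero_char`), `DegenerateCMTypesAbelianStabilizerCharacters`
(`AbelianStabilizer.sum_char_image_mul_eq`), `CMTypeRankCharactersNumberField` (`two_mul_ncard_oddCharacters_eq_card`).
-/

open scoped BigOperators Classical

namespace Literature.NumberTheory.ComplexMultiplication

namespace CyclicCMType

namespace ExponentTwo

/-! ## §1 Ordered triples of pairwise distinct elements of a finite set -/

section Triples

variable {α : Type*} [DecidableEq α]

/-- `#{c ∈ Q : a ≠ c ∧ b ≠ c} = |Q| − 2` for `a ≠ b` in `Q`. [folklore] -/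
private theorem card_filter_ne_ne_eq (Q : Finset α) {a b : α} (ha : a ∈ Q) (hb : b ∈ Q) (hab : a ≠ b) :
    (Q.filter fun c => a ≠ c ∧ b ≠ c).card = Q.card - 2 := by
  have h1 : (Q.filter fun c => a ≠ c ∧ b ≠ c) = (Q.erase a).erase b := by
    ext c
    simp only [Finset.mem_filter, Finset.mem_erase, ne_comm (a := a), ne_comm (a := b)]
    tauto
  rw [h1, Finset.card_erase_of_mem (Finset.mem_erase.2 ⟨hab.symm, hb⟩), Finset.card_erase_of_mem ha]
  omega

/-- **The number of ordered triples of pairwise distinct elements of a finite set `Q` is `|Q|(|Q| − 1)(|Q| − 2).**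
[folklore] -/
private theorem card_filter_triples_pairwise_ne (Q : Finset α) :
    ((Q ×ˢ Q ×ˢ Q).filter fun t : α × α × α => t.1 ≠ t.2.1 ∧ t.1 ≠ t.2.2 ∧ t.2.1 ≠ t.2.2).card =
      Q.card * (Q.card - 1) * (Q.card - 2) := by
  rw [Finset.card_filter, Finset.sum_product]
  have inner : ∀ a ∈ Q, ∀ b ∈ Q,
      (∑ c ∈ Q, if a ≠ b ∧ a ≠ c ∧ b ≠ c then 1 else 0) = if a ≠ b then Q.card - 2 else 0 := by
    intro a ha b hb
    by_cases hab : a ≠ b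
    · rw [if_pos hab]
      have : (∑ c ∈ Q, if a ≠ b ∧ a ≠ c ∧ b ≠ c then 1 else 0) = ∑ c ∈ Q, if a ≠ c ∧ b ≠ c then 1 else 0 :=
        Finset.sum_congr rfl fun c _ => by simp only [ne_eq, hab, not_false_eq_true, true_and]
      rw [this, ← Finset.card_filter, card_filter_ne_ne_eq Q ha hb hab]
    · rw [if_neg hab]
      exact Finset.sum_eq_zero fun c _ => by rw [if_neg (fun h => hab h.1)]
  have middle : ∀ a ∈ Q, (∑ bc ∈ Q ×ˢ Q, if (a, bc).1 ≠ (a, bc).2.1 ∧ (a, bc).1 ≠ (a, bc).2.2 ∧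
      (a, bc).2.1 ≠ (a, bc).2.2 then 1 else 0) = (Q.card - 1) * (Q.card - 2) := by
    intro a ha
    rw [Finset.sum_product]
    simp only
    rw [Finset.sum_congr rfl fun b hb => inner a ha b hb, Finset.sum_ite, Finset.sum_const_zero, add_zero,
      Finset.sum_const, smul_eq_mul]
    have : (Q.filter fun b => a ≠ b) = Q.erase a := by
      ext b
      simp only [Finset.mem_filter, Finset.mem_erase, ne_comm (a := a)]
      tauto
    rw [this, Finset.card_erase_of_mem ha]
  rw [Finset.sum_congr rfl fun a ha => middle a ha, Finset.sum_const, smul_eq_mul]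
  ring

end Triples

variable {G : Type*} [CommGroup G] [Fintype G] [DecidableEq G] {ρ : G} {T : Finset G}
  {χ₁ χ₂ χ₃ : AddChar (Additive G) ℂ}

/-! ## §2 Helpers: exponent `2`, translates read through a predicate -/

section Helpers

omit [Fintype G] [DecidableEq G] in
/-- `g·g = 1` in exponent `2`. [folklore] -/
private theorem mul_self_eq_one_rc (hexp : ∀ g : G, g ^ 2 = 1) (g : G) : g * g = 1 := by
  rw [← pow_two]; exact hexp g

omit [Fintype G] [DecidableEq G] in
/-- `u(ux) = x` in exponent `2`. [folklore] -/
private theorem mul_mul_cancel_rc (hexp : ∀ g : G, g ^ 2 = 1) (u x : G) : u * (u * x) = x := by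
  rw [← mul_assoc, mul_self_eq_one_rc hexp u, one_mul]

omit [Fintype G] [DecidableEq G] in
/-- `χ(g) ≠ 0`. [folklore] -/
private theorem char_ne_zero_rc (χ : AddChar (Additive G) ℂ) (g : G) : χ (Additive.ofMul g) ≠ 0 := by
  intro h0
  have h1 : χ (Additive.ofMul g) * χ (Additive.ofMul g⁻¹) = 1 := by
    rw [← AddChar.map_add_eq_mul, ← ofMul_mul, mul_inv_cancel, ofMul_one, AddChar.map_zero_eq_one]
  rw [h0, zero_mul] at h1
  exact zero_ne_one h1

omit [Fintype G] [DecidableEq G] in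
/-- An odd character is non-trivial. [folklore] -/
private theorem ne_zero_of_odd_rc {χ : AddChar (Additive G) ℂ} (hχ : χ (Additive.ofMul ρ) = -1) : χ ≠ 0 := by
  intro h0
  rw [h0, AddChar.zero_apply] at hχ
  norm_num at hχ

omit [Fintype G] [DecidableEq G] in
/-- `−χ = χ` for characters of a group of exponent `2`. [folklore] -/
private theorem neg_eq_self_rc (hexp : ∀ g : G, g ^ 2 = 1) (χ : AddChar (Additive G) ℂ) : -χ = χ := by
  rw [neg_eq_iff_add_eq_zero, ExponentTwo.add_self_eq_zero_char hexp χ]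

omit [Fintype G] [DecidableEq G] in
/-- In exponent `2`, distinct characters have non-trivial product. [cite: Kubota1965, §4 Lemma 2 (proof)] -/
private theorem add_ne_zero_of_ne_rc (hexp : ∀ g : G, g ^ 2 = 1) {χ χ' : AddChar (Additive G) ℂ} (hne : χ ≠ χ') :
    χ + χ' ≠ 0 := by
  intro h0
  exact hne (add_left_cancel ((ExponentTwo.add_self_eq_zero_char hexp χ).trans h0.symm))

omit [Fintype G] [DecidableEq G] in
/-- `χ₁ ≠ χ₁χ₂χ₃`, `χ₂ ≠ χ₁χ₂χ₃`, `χ₃ ≠ χ₁χ₂χ₃` for distinct `χᵢ` (exponent `2`). [folklore] -/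
private theorem ne_add_add_rc (hexp : ∀ g : G, g ^ 2 = 1) (h12 : χ₁ ≠ χ₂) (h13 : χ₁ ≠ χ₃) (h23 : χ₂ ≠ χ₃) :
    χ₁ ≠ χ₁ + χ₂ + χ₃ ∧ χ₂ ≠ χ₁ + χ₂ + χ₃ ∧ χ₃ ≠ χ₁ + χ₂ + χ₃ := by
  refine ⟨fun h => add_ne_zero_of_ne_rc hexp h23 ?_, fun h => add_ne_zero_of_ne_rc hexp h13 ?_,
    fun h => add_ne_zero_of_ne_rc hexp h12 ?_⟩
  · have : χ₁ + 0 = χ₁ + (χ₂ + χ₃) := by rw [add_zero, ← add_assoc]; exact h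
    exact (add_left_cancel this).symm
  · have : χ₂ + 0 = χ₂ + (χ₁ + χ₃) := by
      rw [add_zero]
      calc χ₂ = χ₁ + χ₂ + χ₃ := h
        _ = χ₂ + (χ₁ + χ₃) := by abel
    exact (add_left_cancel this).symm
  · have : χ₃ + 0 = χ₃ + (χ₁ + χ₂) := by
      rw [add_zero]
      calc χ₃ = χ₁ + χ₂ + χ₃ := h
        _ = χ₃ + (χ₁ + χ₂) := by abel
    exact (add_left_cancel this).symm

omit [Fintype G] [DecidableEq G] in
/-- `#{χ₁, χ₂, χ₃, χ₁χ₂χ₃} = 4` for distinct `χᵢ` (exponent `2`). [folklore] -/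
private theorem card_quad_rc (hexp : ∀ g : G, g ^ 2 = 1) (h12 : χ₁ ≠ χ₂) (h13 : χ₁ ≠ χ₃) (h23 : χ₂ ≠ χ₃) :
    ({χ₁, χ₂, χ₃, χ₁ + χ₂ + χ₃} : Finset (AddChar (Additive G) ℂ)).card = 4 := by
  obtain ⟨h1, h2, h3⟩ := ne_add_add_rc hexp h12 h13 h23
  rw [Finset.card_insert_of_notMem, Finset.card_insert_of_notMem, Finset.card_pair h3]
  · simp only [Finset.mem_insert, Finset.mem_singleton, not_or]; exact ⟨h23, h2⟩
  · simp only [Finset.mem_insert, Finset.mem_singleton, not_or]; exact ⟨h12, h13, h1⟩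

omit [Fintype G] [DecidableEq G] in
/-- `Σ_{χ ∈ {χ₁, χ₂, χ₃, χ₁χ₂χ₃}} χ = 0` (exponent `2`). [folklore] -/
private theorem sum_quad_rc (hexp : ∀ g : G, g ^ 2 = 1) (h12 : χ₁ ≠ χ₂) (h13 : χ₁ ≠ χ₃) (h23 : χ₂ ≠ χ₃) :
    ∑ χ ∈ ({χ₁, χ₂, χ₃, χ₁ + χ₂ + χ₃} : Finset (AddChar (Additive G) ℂ)), χ = 0 := by
  obtain ⟨h1, h2, h3⟩ := ne_add_add_rc hexp h12 h13 h23
  rw [Finset.sum_insert, Finset.sum_insert, Finset.sum_pair h3]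
  · calc χ₁ + (χ₂ + (χ₃ + (χ₁ + χ₂ + χ₃))) = (χ₁ + χ₂ + χ₃) + (χ₁ + χ₂ + χ₃) := by abel
      _ = 0 := ExponentTwo.add_self_eq_zero_char hexp _
  · simp only [Finset.mem_insert, Finset.mem_singleton, not_or]; exact ⟨h23, h2⟩
  · simp only [Finset.mem_insert, Finset.mem_singleton, not_or]; exact ⟨h12, h13, h1⟩

omit [Fintype G] [DecidableEq G] in
/-- Reading a translate through a predicate: if `x ∈ F ⟺ P(ux)` then `ug ∈ F ⟺ P(g)`. [folklore] -/
private theorem forall_mul_mem_iff_of_mem_iff (hexp : ∀ g : G, g ^ 2 = 1) {P : G → Prop} {F : Finset G} {u : G}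
    (hF : ∀ x : G, x ∈ F ↔ P (u * x)) (g : G) : u * g ∈ F ↔ P g := by
  rw [hF, mul_mul_cancel_rc hexp]

omit [Fintype G] [DecidableEq G] in
/-- Conversely: if `ug ∈ T ⟺ P(g)` then `x ∈ T ⟺ P(ux)`. [folklore] -/
private theorem mem_iff_of_forall_mul_mem_iff (hexp : ∀ g : G, g ^ 2 = 1) {P : G → Prop} {u : G}
    (hT : ∀ g : G, u * g ∈ T ↔ P g) (x : G) : x ∈ T ↔ P (u * x) := by
  rw [← hT (u * x), mul_mul_cancel_rc hexp]

omit [Fintype G] [DecidableEq G] in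
/-- Uniqueness: a finset is determined by `ug ∈ T ⟺ P(g)`. [folklore] -/
private theorem eq_of_forall_mul_mem_iff (hexp : ∀ g : G, g ^ 2 = 1) {P : G → Prop} {F : Finset G} {u : G}
    (hT : ∀ g : G, u * g ∈ T ↔ P g) (hF : ∀ x : G, x ∈ F ↔ P (u * x)) : T = F := by
  ext x
  rw [mem_iff_of_forall_mul_mem_iff hexp hT, hF]

omit [Fintype G] in
/-- A translate read through a predicate is the image `M·u` of `M = {g : P(g)}`. [folklore] -/
private theorem eq_image_mul_of_mem_iff (hexp : ∀ g : G, g ^ 2 = 1) {P : G → Prop} {F M : Finset G} {u : G}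
    (hF : ∀ x : G, x ∈ F ↔ P (u * x)) (hM : ∀ g : G, g ∈ M ↔ P g) : F = M.image fun s => s * u := by
  ext x
  rw [hF, Finset.mem_image]
  constructor
  · intro hx
    exact ⟨u * x, (hM _).2 hx, by rw [mul_comm u x, mul_assoc, mul_self_eq_one_rc hexp u, mul_one]⟩
  · rintro ⟨s, hs, rfl⟩
    rw [mul_comm s u, mul_mul_cancel_rc hexp]
    exact (hM s).1 hs

omit [Fintype G] in
/-- **Character sums of a translate**: `Σ_{x ∈ F} χ(x) = χ(u)·Σ_{s ∈ M} χ(s)` for `F = Mu`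
(tree `AbelianStabilizer.sum_char_image_mul_eq`). [cite: Kubota1965, §4 Lemma 2] -/
theorem sum_char_eq_of_mem_iff (hexp : ∀ g : G, g ^ 2 = 1) {P : G → Prop} {F M : Finset G} {u : G}
    (hF : ∀ x : G, x ∈ F ↔ P (u * x)) (hM : ∀ g : G, g ∈ M ↔ P g) (χ : AddChar (Additive G) ℂ) :
    ∑ x ∈ F, χ (Additive.ofMul x) = χ (Additive.ofMul u) * ∑ s ∈ M, χ (Additive.ofMul s) := by
  rw [eq_image_mul_of_mem_iff hexp hF hM]
  exact AbelianStabilizer.sum_char_image_mul_eq χ M u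

/-- **A translate has the same survivors.** [cite: Kubota1965, §4 Lemma 2] -/
theorem filter_sum_ne_zero_eq_of_mem_iff (hexp : ∀ g : G, g ^ 2 = 1) {P : G → Prop} {F M : Finset G} {u : G}
    (hF : ∀ x : G, x ∈ F ↔ P (u * x)) (hM : ∀ g : G, g ∈ M ↔ P g) :
    ((Finset.univ.filter fun χ : AddChar (Additive G) ℂ => χ (Additive.ofMul ρ) = -1).filter
      fun χ => ∑ s ∈ F, χ (Additive.ofMul s) ≠ 0) =
      ((Finset.univ.filter fun χ : AddChar (Additive G) ℂ => χ (Additive.ofMul ρ) = -1).filter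
        fun χ => ∑ s ∈ M, χ (Additive.ofMul s) ≠ 0) := by
  refine Finset.filter_congr fun χ _ => ?_
  rw [sum_char_eq_of_mem_iff hexp hF hM χ, mul_ne_zero_iff]
  exact ⟨fun h => h.2, fun h => ⟨char_ne_zero_rc χ u, h⟩⟩

end Helpers

/-! ## §3 Translates of a majority type: CM type, survivors, and the translating elements -/

section Majority

/-- **A translate `T` of `Maj(χ₁, χ₂, χ₃)` (`ug ∈ T ⟺ Maj(g)`) is a CM type.** [cite: Kubota1965, §2] -/
theorem isCMTypeWith_of_majority_translate (hexp : ∀ g : G, g ^ 2 = 1)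
    (hχ₁ : χ₁ (Additive.ofMul ρ) = -1) (hχ₂ : χ₂ (Additive.ofMul ρ) = -1)
    (hχ₃ : χ₃ (Additive.ofMul ρ) = -1) {u : G}
    (hT : ∀ g : G, u * g ∈ T ↔ (χ₁ (Additive.ofMul g) = 1 ∧ χ₂ (Additive.ofMul g) = 1) ∨
      (χ₁ (Additive.ofMul g) = 1 ∧ χ₃ (Additive.ofMul g) = 1) ∨
      (χ₂ (Additive.ofMul g) = 1 ∧ χ₃ (Additive.ofMul g) = 1)) :
    IsCMTypeWith ρ (T : Set G) := by
  have hρ2 : ρ * ρ = 1 := mul_self_eq_one_rc hexp ρ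
  obtain ⟨M, hM⟩ : ∃ M : Finset G, ∀ g : G, g ∈ M ↔ (χ₁ (Additive.ofMul g) = 1 ∧ χ₂ (Additive.ofMul g) = 1) ∨
      (χ₁ (Additive.ofMul g) = 1 ∧ χ₃ (Additive.ofMul g) = 1) ∨
      (χ₂ (Additive.ofMul g) = 1 ∧ χ₃ (Additive.ofMul g) = 1) :=
    ⟨Finset.univ.filter fun g : G => (χ₁ (Additive.ofMul g) = 1 ∧ χ₂ (Additive.ofMul g) = 1) ∨
      (χ₁ (Additive.ofMul g) = 1 ∧ χ₃ (Additive.ofMul g) = 1) ∨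
      (χ₂ (Additive.ofMul g) = 1 ∧ χ₃ (Additive.ofMul g) = 1),
      fun g => by simp only [Finset.mem_filter, Finset.mem_univ, true_and]⟩
  rw [eq_image_mul_of_mem_iff hexp (mem_iff_of_forall_mul_mem_iff hexp hT) hM]
  exact AbelianTranslate.isCMTypeWith_image_mul (isCMTypeWith_of_majority hexp hρ2 hχ₁ hχ₂ hχ₃ hM) u

/-- **The survivors of a translate of `Maj(χ₁, χ₂, χ₃)` are `χ₁, χ₂, χ₃, χ₁χ₂χ₃`** (tree `survivors_eq_of_majority`
for `Maj` itself; a translate has the same survivors). [cite: Kubota1965, §4 Lemma 2]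
[cite: Dodson1984, §3.1.1 Theorem] -/
theorem filter_survivors_eq_of_majority_translate (hexp : ∀ g : G, g ^ 2 = 1)
    (hχ₁ : χ₁ (Additive.ofMul ρ) = -1) (hχ₂ : χ₂ (Additive.ofMul ρ) = -1)
    (hχ₃ : χ₃ (Additive.ofMul ρ) = -1)
    (h12 : χ₁ ≠ χ₂) (h13 : χ₁ ≠ χ₃) (h23 : χ₂ ≠ χ₃) {u : G}
    (hT : ∀ g : G, u * g ∈ T ↔ (χ₁ (Additive.ofMul g) = 1 ∧ χ₂ (Additive.ofMul g) = 1) ∨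
      (χ₁ (Additive.ofMul g) = 1 ∧ χ₃ (Additive.ofMul g) = 1) ∨
      (χ₂ (Additive.ofMul g) = 1 ∧ χ₃ (Additive.ofMul g) = 1)) :
    ((Finset.univ.filter fun χ : AddChar (Additive G) ℂ => χ (Additive.ofMul ρ) = -1).filter
      fun χ => ∑ s ∈ T, χ (Additive.ofMul s) ≠ 0) = {χ₁, χ₂, χ₃, χ₁ + χ₂ + χ₃} := by
  have hρ2 : ρ * ρ = 1 := mul_self_eq_one_rc hexp ρ
  obtain ⟨M, hM⟩ : ∃ M : Finset G, ∀ g : G, g ∈ M ↔ (χ₁ (Additive.ofMul g) = 1 ∧ χ₂ (Additive.ofMul g) = 1) ∨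
      (χ₁ (Additive.ofMul g) = 1 ∧ χ₃ (Additive.ofMul g) = 1) ∨
      (χ₂ (Additive.ofMul g) = 1 ∧ χ₃ (Additive.ofMul g) = 1) :=
    ⟨Finset.univ.filter fun g : G => (χ₁ (Additive.ofMul g) = 1 ∧ χ₂ (Additive.ofMul g) = 1) ∨
      (χ₁ (Additive.ofMul g) = 1 ∧ χ₃ (Additive.ofMul g) = 1) ∨
      (χ₂ (Additive.ofMul g) = 1 ∧ χ₃ (Additive.ofMul g) = 1),
      fun g => by simp only [Finset.mem_filter, Finset.mem_univ, true_and]⟩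
  rw [filter_sum_ne_zero_eq_of_mem_iff hexp (mem_iff_of_forall_mul_mem_iff hexp hT) hM]
  exact survivors_eq_of_majority hexp hρ2 hχ₁ hχ₂ hχ₃ h12 h13 h23 hM

/-- **Two translates of `Maj(χ₁, χ₂, χ₃)` coincide iff the translating elements differ by an element of the joint
kernel `N = ker χ₁ ∩ ker χ₂ ∩ ker χ₃`** (the stabiliser of `Maj`, tree `forall_mul_mem_iff_iff_of_majority`).
[cite: Kubota1965, §2] [cite: Kubota1965, §4 Lemma 2] -/
theorem forall_majority_mul_iff_iff (hexp : ∀ g : G, g ^ 2 = 1)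
    (hχ₁ : χ₁ (Additive.ofMul ρ) = -1) (hχ₂ : χ₂ (Additive.ofMul ρ) = -1)
    (hχ₃ : χ₃ (Additive.ofMul ρ) = -1)
    (h12 : χ₁ ≠ χ₂) (h13 : χ₁ ≠ χ₃) (h23 : χ₂ ≠ χ₃) (u u₀ : G) :
    (∀ x : G, ((χ₁ (Additive.ofMul (u * x)) = 1 ∧ χ₂ (Additive.ofMul (u * x)) = 1) ∨
        (χ₁ (Additive.ofMul (u * x)) = 1 ∧ χ₃ (Additive.ofMul (u * x)) = 1) ∨
        (χ₂ (Additive.ofMul (u * x)) = 1 ∧ χ₃ (Additive.ofMul (u * x)) = 1)) ↔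
        ((χ₁ (Additive.ofMul (u₀ * x)) = 1 ∧ χ₂ (Additive.ofMul (u₀ * x)) = 1) ∨
        (χ₁ (Additive.ofMul (u₀ * x)) = 1 ∧ χ₃ (Additive.ofMul (u₀ * x)) = 1) ∨
        (χ₂ (Additive.ofMul (u₀ * x)) = 1 ∧ χ₃ (Additive.ofMul (u₀ * x)) = 1))) ↔
      χ₁ (Additive.ofMul (u * u₀)) = 1 ∧ χ₂ (Additive.ofMul (u * u₀)) = 1 ∧ χ₃ (Additive.ofMul (u * u₀)) = 1 := by
  have hρ2 : ρ * ρ = 1 := mul_self_eq_one_rc hexp ρ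
  obtain ⟨M, hM⟩ : ∃ M : Finset G, ∀ g : G, g ∈ M ↔ (χ₁ (Additive.ofMul g) = 1 ∧ χ₂ (Additive.ofMul g) = 1) ∨
      (χ₁ (Additive.ofMul g) = 1 ∧ χ₃ (Additive.ofMul g) = 1) ∨
      (χ₂ (Additive.ofMul g) = 1 ∧ χ₃ (Additive.ofMul g) = 1) :=
    ⟨Finset.univ.filter fun g : G => (χ₁ (Additive.ofMul g) = 1 ∧ χ₂ (Additive.ofMul g) = 1) ∨
      (χ₁ (Additive.ofMul g) = 1 ∧ χ₃ (Additive.ofMul g) = 1) ∨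
      (χ₂ (Additive.ofMul g) = 1 ∧ χ₃ (Additive.ofMul g) = 1),
      fun g => by simp only [Finset.mem_filter, Finset.mem_univ, true_and]⟩
  rw [← forall_mul_mem_iff_iff_of_majority hexp hρ2 hχ₁ hχ₂ hχ₃ h12 h13 h23 hM (u * u₀)]
  simp only [← hM]
  constructor
  · intro H y
    have h1 := H (u₀ * y)
    rw [mul_mul_cancel_rc hexp, ← mul_assoc] at h1
    rw [mul_comm y]
    exact h1
  · intro H x
    have h1 := H (u₀ * x)
    rw [mul_comm (u₀ * x), mul_assoc, mul_mul_cancel_rc hexp] at h1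
    exact h1

/-- **The elements translating `Maj(χ₁, χ₂, χ₃)` onto a given translate `T` form a coset of the joint kernel; there
are `|G|/8` of them**: `8 · #{u : x ∈ T ⟺ Maj(ux) ∀ x} = |G|`. [cite: Kubota1965, §2]
[cite: Kubota1965, §4 Lemma 2 (proof)] -/
theorem eight_mul_card_filter_translating_eq (hexp : ∀ g : G, g ^ 2 = 1)
    (hχ₁ : χ₁ (Additive.ofMul ρ) = -1) (hχ₂ : χ₂ (Additive.ofMul ρ) = -1)
    (hχ₃ : χ₃ (Additive.ofMul ρ) = -1)
    (h12 : χ₁ ≠ χ₂) (h13 : χ₁ ≠ χ₃) (h23 : χ₂ ≠ χ₃) {u₀ : G}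
    (hT : ∀ g : G, u₀ * g ∈ T ↔ (χ₁ (Additive.ofMul g) = 1 ∧ χ₂ (Additive.ofMul g) = 1) ∨
      (χ₁ (Additive.ofMul g) = 1 ∧ χ₃ (Additive.ofMul g) = 1) ∨
      (χ₂ (Additive.ofMul g) = 1 ∧ χ₃ (Additive.ofMul g) = 1)) :
    8 * (Finset.univ.filter fun u : G => ∀ x : G, x ∈ T ↔
      (χ₁ (Additive.ofMul (u * x)) = 1 ∧ χ₂ (Additive.ofMul (u * x)) = 1) ∨
        (χ₁ (Additive.ofMul (u * x)) = 1 ∧ χ₃ (Additive.ofMul (u * x)) = 1) ∨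
        (χ₂ (Additive.ofMul (u * x)) = 1 ∧ χ₃ (Additive.ofMul (u * x)) = 1)).card = Fintype.card G := by
  have hker := eight_mul_card_filter_eq_eq_eq_of_odd hexp hχ₁ hχ₂ hχ₃ h12 h13 h23
    (s₁ := (1 : ℂ)) (s₂ := (1 : ℂ)) (s₃ := (1 : ℂ)) (Or.inl rfl) (Or.inl rfl) (Or.inl rfl)
  have hset : (Finset.univ.filter fun u : G => ∀ x : G, x ∈ T ↔
        (χ₁ (Additive.ofMul (u * x)) = 1 ∧ χ₂ (Additive.ofMul (u * x)) = 1) ∨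
          (χ₁ (Additive.ofMul (u * x)) = 1 ∧ χ₃ (Additive.ofMul (u * x)) = 1) ∨
          (χ₂ (Additive.ofMul (u * x)) = 1 ∧ χ₃ (Additive.ofMul (u * x)) = 1)) =
      (Finset.univ.filter fun g : G => χ₁ (Additive.ofMul g) = 1 ∧ χ₂ (Additive.ofMul g) = 1 ∧
        χ₃ (Additive.ofMul g) = 1).image fun n => n * u₀ := by
    ext u
    simp only [Finset.mem_filter, Finset.mem_univ, true_and, Finset.mem_image]
    have key : (∀ x : G, x ∈ T ↔
        (χ₁ (Additive.ofMul (u * x)) = 1 ∧ χ₂ (Additive.ofMul (u * x)) = 1) ∨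
          (χ₁ (Additive.ofMul (u * x)) = 1 ∧ χ₃ (Additive.ofMul (u * x)) = 1) ∨
          (χ₂ (Additive.ofMul (u * x)) = 1 ∧ χ₃ (Additive.ofMul (u * x)) = 1)) ↔
        χ₁ (Additive.ofMul (u * u₀)) = 1 ∧ χ₂ (Additive.ofMul (u * u₀)) = 1 ∧ χ₃ (Additive.ofMul (u * u₀)) = 1 := by
      rw [← forall_majority_mul_iff_iff hexp hχ₁ hχ₂ hχ₃ h12 h13 h23 u u₀]
      refine forall_congr' fun x => ?_
      rw [mem_iff_of_forall_mul_mem_iff hexp hT x]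
      exact Iff.comm
    rw [key]
    constructor
    · intro h
      exact ⟨u * u₀, h, by rw [mul_assoc, mul_self_eq_one_rc hexp u₀, mul_one]⟩
    · rintro ⟨n, hn, rfl⟩
      rw [mul_assoc, mul_self_eq_one_rc hexp u₀, mul_one]
      exact hn
  rw [hset, Finset.card_image_of_injective _ (mul_left_injective u₀)]
  exact hker

end Majority

/-! ## §4 The survivor quadruples `{χ₁, χ₂, χ₃, χ₁χ₂χ₃}` and the `24` ordered triples spanning each -/

section Quads

omit [Fintype G] [DecidableEq G] in
/-- **In a `4`-set `Q` of characters with `Σ_Q χ = 0` (exponent `2`), any three distinct members `a, b, c` have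
`{a, b, c, abc} = Q`** (the fourth member is `abc`). [folklore] -/
private theorem quad_eq_of_mem (hexp : ∀ g : G, g ^ 2 = 1) {Q : Finset (AddChar (Additive G) ℂ)} (hQ4 : Q.card = 4)
    (hQ0 : ∑ χ ∈ Q, χ = 0) {a b c : AddChar (Additive G) ℂ} (ha : a ∈ Q) (hb : b ∈ Q) (hc : c ∈ Q) (hab : a ≠ b)
    (hac : a ≠ c) (hbc : b ≠ c) : ({a, b, c, a + b + c} : Finset (AddChar (Additive G) ℂ)) = Q := by
  classical
  have hbR : b ∈ Q.erase a := Finset.mem_erase.2 ⟨hab.symm, hb⟩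
  have hcR : c ∈ (Q.erase a).erase b := Finset.mem_erase.2 ⟨hbc.symm, Finset.mem_erase.2 ⟨hac.symm, hc⟩⟩
  have hR1 : (((Q.erase a).erase b).erase c).card = 1 := by
    rw [Finset.card_erase_of_mem hcR, Finset.card_erase_of_mem hbR, Finset.card_erase_of_mem ha, hQ4]
  obtain ⟨d, hRd⟩ := Finset.card_eq_one.1 hR1
  have hsum : ∑ χ ∈ ((Q.erase a).erase b).erase c, χ = 0 - a - b - c := by
    rw [Finset.sum_erase_eq_sub hcR, Finset.sum_erase_eq_sub hbR, Finset.sum_erase_eq_sub ha, hQ0]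
  rw [hRd, Finset.sum_singleton] at hsum
  have hd : d = a + b + c :=
    calc d = 0 - a - b - c := hsum
      _ = -(a + b + c) := by abel
      _ = a + b + c := neg_eq_self_rc hexp _
  have hdR : d ∈ ((Q.erase a).erase b).erase c := by rw [hRd]; exact Finset.mem_singleton_self d
  simp only [Finset.mem_erase] at hdR
  obtain ⟨hdc, hdb, hda, hdQ⟩ := hdR
  rw [← hd]
  refine Finset.eq_of_subset_of_card_le (fun x hx => ?_) ?_
  · simp only [Finset.mem_insert, Finset.mem_singleton] at hx
    rcases hx with rfl | rfl | rfl | rfl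
    exacts [ha, hb, hc, hdQ]
  · rw [hQ4, Finset.card_insert_of_notMem, Finset.card_insert_of_notMem, Finset.card_pair (Ne.symm hdc)]
    · simp only [Finset.mem_insert, Finset.mem_singleton, not_or]; exact ⟨hbc, Ne.symm hdb⟩
    · simp only [Finset.mem_insert, Finset.mem_singleton, not_or]; exact ⟨hab, hac, Ne.symm hda⟩

omit [DecidableEq G] in
/-- **The ordered triples of distinct odd characters spanning a given survivor quadruple `Q` (`|Q| = 4`,
`Σ_Q χ = 0`, `Q` odd) are exactly the ordered triples of distinct members of `Q`.** [folklore] -/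
private theorem filter_triples_quad_eq (hexp : ∀ g : G, g ^ 2 = 1) {Q : Finset (AddChar (Additive G) ℂ)}
    (hQ4 : Q.card = 4) (hQ0 : ∑ χ ∈ Q, χ = 0)
    (hQodd : Q ⊆ (Finset.univ.filter fun χ : AddChar (Additive G) ℂ => χ (Additive.ofMul ρ) = -1)) :
    ((((Finset.univ.filter fun χ : AddChar (Additive G) ℂ => χ (Additive.ofMul ρ) = -1) ×ˢ
        (Finset.univ.filter fun χ : AddChar (Additive G) ℂ => χ (Additive.ofMul ρ) = -1) ×ˢ
        (Finset.univ.filter fun χ : AddChar (Additive G) ℂ => χ (Additive.ofMul ρ) = -1)).filter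
      fun τ => τ.1 ≠ τ.2.1 ∧ τ.1 ≠ τ.2.2 ∧ τ.2.1 ≠ τ.2.2).filter
      fun τ => ({τ.1, τ.2.1, τ.2.2, τ.1 + τ.2.1 + τ.2.2} : Finset (AddChar (Additive G) ℂ)) = Q) =
      (Q ×ˢ Q ×ˢ Q).filter fun τ => τ.1 ≠ τ.2.1 ∧ τ.1 ≠ τ.2.2 ∧ τ.2.1 ≠ τ.2.2 := by
  ext ⟨a, b, c⟩
  simp only [Finset.mem_filter, Finset.mem_product]
  constructor
  · rintro ⟨⟨-, hne⟩, hq⟩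
    refine ⟨⟨?_, ?_, ?_⟩, hne⟩
    · rw [← hq]; simp
    · rw [← hq]; simp
    · rw [← hq]; simp
  · rintro ⟨⟨ha, hb, hc⟩, hab, hac, hbc⟩
    exact ⟨⟨⟨Finset.mem_filter.1 (hQodd ha), Finset.mem_filter.1 (hQodd hb), Finset.mem_filter.1 (hQodd hc)⟩,
      hab, hac, hbc⟩, quad_eq_of_mem hexp hQ4 hQ0 ha hb hc hab hac hbc⟩

omit [DecidableEq G] in
/-- **Each survivor quadruple is spanned by exactly `24` ordered triples of distinct odd characters.** [folklore] -/
private theorem card_filter_triples_quad_eq (hexp : ∀ g : G, g ^ 2 = 1) {Q : Finset (AddChar (Additive G) ℂ)}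
    (hQ4 : Q.card = 4) (hQ0 : ∑ χ ∈ Q, χ = 0)
    (hQodd : Q ⊆ (Finset.univ.filter fun χ : AddChar (Additive G) ℂ => χ (Additive.ofMul ρ) = -1)) :
    ((((Finset.univ.filter fun χ : AddChar (Additive G) ℂ => χ (Additive.ofMul ρ) = -1) ×ˢ
        (Finset.univ.filter fun χ : AddChar (Additive G) ℂ => χ (Additive.ofMul ρ) = -1) ×ˢ
        (Finset.univ.filter fun χ : AddChar (Additive G) ℂ => χ (Additive.ofMul ρ) = -1)).filter
      fun τ => τ.1 ≠ τ.2.1 ∧ τ.1 ≠ τ.2.2 ∧ τ.2.1 ≠ τ.2.2).filter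
      fun τ => ({τ.1, τ.2.1, τ.2.2, τ.1 + τ.2.1 + τ.2.2} : Finset (AddChar (Additive G) ℂ)) = Q).card = 24 := by
  rw [filter_triples_quad_eq hexp hQ4 hQ0 hQodd, card_filter_triples_pairwise_ne, hQ4]

omit [Fintype G] [DecidableEq G] in
/-- `χ₁χ₂χ₃` is odd for odd `χᵢ`. [folklore] -/
private theorem add_add_apply_rho_rc (hχ₁ : χ₁ (Additive.ofMul ρ) = -1) (hχ₂ : χ₂ (Additive.ofMul ρ) = -1)
    (hχ₃ : χ₃ (Additive.ofMul ρ) = -1) :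
    (χ₁ + χ₂ + χ₃) (Additive.ofMul ρ) = -1 := by
  rw [AddChar.add_apply, AddChar.add_apply, hχ₁, hχ₂, hχ₃]; norm_num

omit [DecidableEq G] in
/-- The survivor quadruple of three distinct odd characters lies in the odd characters. [folklore] -/
private theorem quad_subset_odd (hχ₁ : χ₁ (Additive.ofMul ρ) = -1) (hχ₂ : χ₂ (Additive.ofMul ρ) = -1)
    (hχ₃ : χ₃ (Additive.ofMul ρ) = -1) :
    ({χ₁, χ₂, χ₃, χ₁ + χ₂ + χ₃} : Finset (AddChar (Additive G) ℂ)) ⊆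
      (Finset.univ.filter fun χ : AddChar (Additive G) ℂ => χ (Additive.ofMul ρ) = -1) := by
  intro χ hχ
  simp only [Finset.mem_insert, Finset.mem_singleton] at hχ
  simp only [Finset.mem_filter, Finset.mem_univ, true_and]
  rcases hχ with rfl | rfl | rfl | rfl
  exacts [hχ₁, hχ₂, hχ₃, add_add_apply_rho_rc hχ₁ hχ₂ hχ₃]

end Quads

/-! ## §5 The fibres of `((χ₁, χ₂, χ₃), u) ↦ Maj(χ₁, χ₂, χ₃)·u` over the rank-`5` types -/

section Fibres

/-- **The translating elements onto a type with survivors `{χ₁, χ₂, χ₃, χ₁χ₂χ₃}` number `|G|/8`**: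
`8 · #{u : {x : Maj(ux)} = T} = |G|`. [cite: Kubota1965, §2] [cite: Kubota1965, §4 Lemma 2]
[cite: Dodson1984, §3.1.1 Theorem] -/
theorem eight_mul_card_filter_translate_eq_of_survivors_eq (hexp : ∀ g : G, g ^ 2 = 1)
    (h : IsCMTypeWith ρ (T : Set G)) (hχ₁ : χ₁ (Additive.ofMul ρ) = -1) (hχ₂ : χ₂ (Additive.ofMul ρ) = -1)
    (hχ₃ : χ₃ (Additive.ofMul ρ) = -1)
    (h12 : χ₁ ≠ χ₂) (h13 : χ₁ ≠ χ₃) (h23 : χ₂ ≠ χ₃)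
    (hsurv : ((Finset.univ.filter fun χ : AddChar (Additive G) ℂ => χ (Additive.ofMul ρ) = -1).filter
      fun χ => ∑ s ∈ T, χ (Additive.ofMul s) ≠ 0) = {χ₁, χ₂, χ₃, χ₁ + χ₂ + χ₃}) :
    8 * (Finset.univ.filter fun u : G =>
      (Finset.univ.filter fun x : G => ((χ₁ (Additive.ofMul (u * x)) = 1 ∧ χ₂ (Additive.ofMul (u * x)) = 1) ∨
        (χ₁ (Additive.ofMul (u * x)) = 1 ∧ χ₃ (Additive.ofMul (u * x)) = 1) ∨
        (χ₂ (Additive.ofMul (u * x)) = 1 ∧ χ₃ (Additive.ofMul (u * x)) = 1))) = T).card = Fintype.card G := by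
  obtain ⟨u₀, hT₀⟩ := exists_forall_mul_mem_iff_majority_of_survivors_eq hexp h hχ₁ hχ₂ hχ₃ h12 h13 h23 hsurv
  rw [← eight_mul_card_filter_translating_eq hexp hχ₁ hχ₂ hχ₃ h12 h13 h23 hT₀]
  congr 2
  refine Finset.filter_congr fun u _ => ?_
  rw [Finset.ext_iff]
  refine forall_congr' fun x => ?_
  simp only [Finset.mem_filter, Finset.mem_univ, true_and]
  exact Iff.comm

/-- **No element translates `Maj(χ₁, χ₂, χ₃)` onto a type with other survivors.** [cite: Kubota1965, §4 Lemma 2] -/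
theorem card_filter_translate_eq_zero_of_survivors_ne (hexp : ∀ g : G, g ^ 2 = 1)
    (hχ₁ : χ₁ (Additive.ofMul ρ) = -1) (hχ₂ : χ₂ (Additive.ofMul ρ) = -1)
    (hχ₃ : χ₃ (Additive.ofMul ρ) = -1) (h12 : χ₁ ≠ χ₂) (h13 : χ₁ ≠ χ₃) (h23 : χ₂ ≠ χ₃)
    (hsurv : ((Finset.univ.filter fun χ : AddChar (Additive G) ℂ => χ (Additive.ofMul ρ) = -1).filter
      fun χ => ∑ s ∈ T, χ (Additive.ofMul s) ≠ 0) ≠ {χ₁, χ₂, χ₃, χ₁ + χ₂ + χ₃}) :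
    (Finset.univ.filter fun u : G =>
      (Finset.univ.filter fun x : G => ((χ₁ (Additive.ofMul (u * x)) = 1 ∧ χ₂ (Additive.ofMul (u * x)) = 1) ∨
        (χ₁ (Additive.ofMul (u * x)) = 1 ∧ χ₃ (Additive.ofMul (u * x)) = 1) ∨
        (χ₂ (Additive.ofMul (u * x)) = 1 ∧ χ₃ (Additive.ofMul (u * x)) = 1))) = T).card = 0 := by
  rw [Finset.card_eq_zero, Finset.filter_eq_empty_iff]
  intro u _ hu
  apply hsurv
  rw [← hu]
  refine filter_survivors_eq_of_majority_translate hexp hχ₁ hχ₂ hχ₃ h12 h13 h23 (u := u)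
    (forall_mul_mem_iff_of_mem_iff hexp fun x => ?_)
  simp only [Finset.mem_filter, Finset.mem_univ, true_and]

omit [Fintype G] [DecidableEq G] in
/-- Counting over a product by slices: `#{(a, b) ∈ s × t : p(a, b)} = Σ_{a ∈ s} #{b ∈ t : p(a, b)}`. [folklore] -/
private theorem card_filter_product_eq_sum_rc {α β : Type*} (s : Finset α) (t : Finset β) (p : α × β → Prop)
    [DecidablePred p] :
    ((s ×ˢ t).filter p).card = ∑ a ∈ s, (t.filter fun b => p (a, b)).card := by
  rw [Finset.card_filter, Finset.sum_product]
  exact Finset.sum_congr rfl fun a _ => (Finset.card_filter _ _).symm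

/-- **THE FIBRE OVER A RANK-`5` TYPE HAS `3|G|` ELEMENTS**: `24` ordered triples spanning its survivor
quadruple, times `|G|/8` translating elements each. [cite: Kubota1965, §2] [cite: Kubota1965, §4 Lemma 2]
[cite: Dodson1984, §3.1.1 Theorem] -/
theorem card_fibre_eq (hexp : ∀ g : G, g ^ 2 = 1) (h : IsCMTypeWith ρ (T : Set G))
    (hr : typeRank G (T : Set G) = 5) :
    (((((Finset.univ.filter fun χ : AddChar (Additive G) ℂ => χ (Additive.ofMul ρ) = -1) ×ˢ
        (Finset.univ.filter fun χ : AddChar (Additive G) ℂ => χ (Additive.ofMul ρ) = -1) ×ˢ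
        (Finset.univ.filter fun χ : AddChar (Additive G) ℂ => χ (Additive.ofMul ρ) = -1)).filter
      fun τ => τ.1 ≠ τ.2.1 ∧ τ.1 ≠ τ.2.2 ∧ τ.2.1 ≠ τ.2.2) ×ˢ (Finset.univ : Finset G)).filter fun p =>
      (fun p : (AddChar (Additive G) ℂ × AddChar (Additive G) ℂ × AddChar (Additive G) ℂ) × G =>
        Finset.univ.filter fun x : G =>
          ((p.1.1 (Additive.ofMul (p.2 * x)) = 1 ∧ p.1.2.1 (Additive.ofMul (p.2 * x)) = 1) ∨
          (p.1.1 (Additive.ofMul (p.2 * x)) = 1 ∧ p.1.2.2 (Additive.ofMul (p.2 * x)) = 1) ∨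
          (p.1.2.1 (Additive.ofMul (p.2 * x)) = 1 ∧ p.1.2.2 (Additive.ofMul (p.2 * x)) = 1))) p =
        T).card = 3 * Fintype.card G := by
  obtain ⟨χ₁, χ₂, χ₃, hχ₁, hχ₂, hχ₃, h12, h13, h23, u, hT⟩ :=
    exists_majority_translate_of_typeRank_eq_five hexp h hr
  have hsurv := filter_survivors_eq_of_majority_translate hexp hχ₁ hχ₂ hχ₃ h12 h13 h23 hT
  have hQ4 := card_quad_rc hexp h12 h13 h23
  have hQ0 := sum_quad_rc hexp h12 h13 h23
  have hQodd := quad_subset_odd (ρ := ρ) hχ₁ hχ₂ hχ₃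
  have h24 := card_filter_triples_quad_eq hexp hQ4 hQ0 hQodd
  rw [card_filter_product_eq_sum_rc]
  simp only
  -- `8 · Σ_τ #(fibre slice at τ) = |G| · #{τ spanning the survivor quadruple} = 24|G|`
  have hslice : ∀ τ ∈ (((Finset.univ.filter fun χ : AddChar (Additive G) ℂ => χ (Additive.ofMul ρ) = -1) ×ˢ
        (Finset.univ.filter fun χ : AddChar (Additive G) ℂ => χ (Additive.ofMul ρ) = -1) ×ˢ
        (Finset.univ.filter fun χ : AddChar (Additive G) ℂ => χ (Additive.ofMul ρ) = -1)).filter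
      fun τ => τ.1 ≠ τ.2.1 ∧ τ.1 ≠ τ.2.2 ∧ τ.2.1 ≠ τ.2.2),
      8 * (Finset.univ.filter fun u : G => (Finset.univ.filter fun x : G =>
        ((τ.1 (Additive.ofMul (u * x)) = 1 ∧ τ.2.1 (Additive.ofMul (u * x)) = 1) ∨
        (τ.1 (Additive.ofMul (u * x)) = 1 ∧ τ.2.2 (Additive.ofMul (u * x)) = 1) ∨
        (τ.2.1 (Additive.ofMul (u * x)) = 1 ∧ τ.2.2 (Additive.ofMul (u * x)) = 1))) = T).card =
      if ({τ.1, τ.2.1, τ.2.2, τ.1 + τ.2.1 + τ.2.2} : Finset (AddChar (Additive G) ℂ)) =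
          {χ₁, χ₂, χ₃, χ₁ + χ₂ + χ₃} then Fintype.card G else 0 := by
    rintro ⟨a, b, c⟩ hτ
    simp only [Finset.mem_filter, Finset.mem_product, Finset.mem_univ, true_and] at hτ
    obtain ⟨⟨ha, hb, hc⟩, hab, hac, hbc⟩ := hτ
    simp only
    split_ifs with hq
    · exact eight_mul_card_filter_translate_eq_of_survivors_eq hexp h ha hb hc hab hac hbc (hsurv.trans hq.symm)
    · rw [card_filter_translate_eq_zero_of_survivors_ne hexp ha hb hc hab hac hbc fun h' =>
        hq (h'.symm.trans hsurv)]
  have h8 : 8 * ∑ τ ∈ (((Finset.univ.filter fun χ : AddChar (Additive G) ℂ => χ (Additive.ofMul ρ) = -1) ×ˢ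
        (Finset.univ.filter fun χ : AddChar (Additive G) ℂ => χ (Additive.ofMul ρ) = -1) ×ˢ
        (Finset.univ.filter fun χ : AddChar (Additive G) ℂ => χ (Additive.ofMul ρ) = -1)).filter
      fun τ => τ.1 ≠ τ.2.1 ∧ τ.1 ≠ τ.2.2 ∧ τ.2.1 ≠ τ.2.2),
      (Finset.univ.filter fun u : G => (Finset.univ.filter fun x : G =>
        ((τ.1 (Additive.ofMul (u * x)) = 1 ∧ τ.2.1 (Additive.ofMul (u * x)) = 1) ∨
        (τ.1 (Additive.ofMul (u * x)) = 1 ∧ τ.2.2 (Additive.ofMul (u * x)) = 1) ∨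
        (τ.2.1 (Additive.ofMul (u * x)) = 1 ∧ τ.2.2 (Additive.ofMul (u * x)) = 1))) = T).card =
      24 * Fintype.card G := by
    rw [Finset.mul_sum, Finset.sum_congr rfl hslice, Finset.sum_ite, Finset.sum_const_zero, add_zero,
      Finset.sum_const, smul_eq_mul, h24]
  omega

end Fibres

/-! ## §6 The census -/

section Census

omit [DecidableEq G] in
/-- `#{odd characters} = |G|/2` as a finset count (tree `two_mul_ncard_oddCharacters_eq_card`,
`AbelianStabilizer.two_mul_card_filter_odd_eq`). [cite: Kubota1965, §4 Lemma 2] -/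
private theorem two_mul_card_filter_odd_eq_rc (hexp : ∀ g : G, g ^ 2 = 1) (hρ1 : ρ ≠ 1) :
    2 * (Finset.univ.filter fun χ : AddChar (Additive G) ℂ => χ (Additive.ofMul ρ) = -1).card = Fintype.card G := by
  have hρ2 : ρ * ρ = 1 := mul_self_eq_one_rc hexp ρ
  have h1 := Literature.AlgebraicGeometry.Pohlmann1968.two_mul_ncard_oddCharacters_eq_card (G := G) hρ1 hρ2
  have hset : {χ : AddChar (Additive G) ℂ | χ (Additive.ofMul ρ) = -1} =
      ↑(Finset.univ.filter fun χ : AddChar (Additive G) ℂ => χ (Additive.ofMul ρ) = -1) := by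
    ext χ; simp
  rwa [hset, Set.ncard_coe_finset] at h1

/-- **THE PARAMETRISATION LANDS IN THE RANK-`5` TYPES**: for distinct odd `χ₁, χ₂, χ₃` and any `u`,
`{x : Maj(ux)}` is a CM type of rank `5`. [cite: Kubota1965, §2] [cite: Kubota1965, §4 Lemma 2] -/
theorem translate_mem_filter_typeRank_eq_five (hexp : ∀ g : G, g ^ 2 = 1)
    {p : (AddChar (Additive G) ℂ × AddChar (Additive G) ℂ × AddChar (Additive G) ℂ) × G}
    (hp : p ∈ (((Finset.univ.filter fun χ : AddChar (Additive G) ℂ => χ (Additive.ofMul ρ) = -1) ×ˢ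
        (Finset.univ.filter fun χ : AddChar (Additive G) ℂ => χ (Additive.ofMul ρ) = -1) ×ˢ
        (Finset.univ.filter fun χ : AddChar (Additive G) ℂ => χ (Additive.ofMul ρ) = -1)).filter
      fun τ => τ.1 ≠ τ.2.1 ∧ τ.1 ≠ τ.2.2 ∧ τ.2.1 ≠ τ.2.2) ×ˢ (Finset.univ : Finset G)) :
    (fun p : (AddChar (Additive G) ℂ × AddChar (Additive G) ℂ × AddChar (Additive G) ℂ) × G =>
        Finset.univ.filter fun x : G =>
          ((p.1.1 (Additive.ofMul (p.2 * x)) = 1 ∧ p.1.2.1 (Additive.ofMul (p.2 * x)) = 1) ∨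
          (p.1.1 (Additive.ofMul (p.2 * x)) = 1 ∧ p.1.2.2 (Additive.ofMul (p.2 * x)) = 1) ∨
          (p.1.2.1 (Additive.ofMul (p.2 * x)) = 1 ∧ p.1.2.2 (Additive.ofMul (p.2 * x)) = 1))) p ∈
      ((Finset.univ : Finset (Finset G)).filter fun T : Finset G =>
      IsCMTypeWith ρ (T : Set G) ∧ typeRank G (T : Set G) = 5) := by
  obtain ⟨⟨χ₁, χ₂, χ₃⟩, u⟩ := p
  simp only [Finset.mem_product, Finset.mem_filter, Finset.mem_univ, true_and, and_true] at hp
  obtain ⟨⟨hχ₁, hχ₂, hχ₃⟩, h12, h13, h23⟩ := hp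
  simp only [Finset.mem_filter, Finset.mem_univ, true_and]
  have hT : ∀ g : G, u * g ∈ (Finset.univ.filter fun x : G =>
        ((χ₁ (Additive.ofMul (u * x)) = 1 ∧ χ₂ (Additive.ofMul (u * x)) = 1) ∨
          (χ₁ (Additive.ofMul (u * x)) = 1 ∧ χ₃ (Additive.ofMul (u * x)) = 1) ∨
          (χ₂ (Additive.ofMul (u * x)) = 1 ∧ χ₃ (Additive.ofMul (u * x)) = 1))) ↔
      (χ₁ (Additive.ofMul g) = 1 ∧ χ₂ (Additive.ofMul g) = 1) ∨
      (χ₁ (Additive.ofMul g) = 1 ∧ χ₃ (Additive.ofMul g) = 1) ∨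
      (χ₂ (Additive.ofMul g) = 1 ∧ χ₃ (Additive.ofMul g) = 1) :=
    forall_mul_mem_iff_of_mem_iff hexp fun x => by simp only [Finset.mem_filter, Finset.mem_univ, true_and]
  exact ⟨isCMTypeWith_of_majority_translate hexp hχ₁ hχ₂ hχ₃ hT,
    typeRank_eq_five_of_majority_translate hexp hχ₁ hχ₂ hχ₃ h12 h13 h23 hT⟩

/-- **CENSUS OF THE RANK-`5` CM TYPES ON A FINITE COMMUTATIVE GROUP OF EXPONENT `2`**: w.r.t. any `ρ ≠ 1`,
the number of CM types `T` (`T ⊔ ρT = G`) of Kubota rank `5` is `2·C(|G|/2, 3)` — on `(ℤ/2)^{n+1}`: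
`2·C(2ⁿ, 3)` of the `2^{2ⁿ}` types (`8` of `16` for `n = 2`, `112` of `256` for `n = 3`, `1120` of `65536`
for `n = 4`).  Proof: the map `((χ₁, χ₂, χ₃), u) ↦ Maj(χ₁, χ₂, χ₃)·u` from (ordered triples of distinct odd
characters) `× G` onto the rank-`5` types (tree `typeRank_eq_five_iff_exists_majority_translate`) has fibres
of size `24 · |G|/8 = 3|G|`. [cite: Kubota1965, §2] [cite: Kubota1965, §4 Lemma 2]
[cite: Dodson1984, §3.1.1 Theorem] [cite: Carlet2020, §6.2 Prop. 94] -/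
theorem card_filter_typeRank_eq_five (hexp : ∀ g : G, g ^ 2 = 1) (hρ1 : ρ ≠ 1) :
    ((Finset.univ : Finset (Finset G)).filter fun T : Finset G =>
      IsCMTypeWith ρ (T : Set G) ∧ typeRank G (T : Set G) = 5).card =
      2 * Nat.choose (Fintype.card G / 2) 3 := by
  have hfib := Finset.card_eq_sum_card_fiberwise
    (f := (fun p : (AddChar (Additive G) ℂ × AddChar (Additive G) ℂ × AddChar (Additive G) ℂ) × G =>
        Finset.univ.filter fun x : G =>
          ((p.1.1 (Additive.ofMul (p.2 * x)) = 1 ∧ p.1.2.1 (Additive.ofMul (p.2 * x)) = 1) ∨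
          (p.1.1 (Additive.ofMul (p.2 * x)) = 1 ∧ p.1.2.2 (Additive.ofMul (p.2 * x)) = 1) ∨
          (p.1.2.1 (Additive.ofMul (p.2 * x)) = 1 ∧ p.1.2.2 (Additive.ofMul (p.2 * x)) = 1))))
    (s := (((Finset.univ.filter fun χ : AddChar (Additive G) ℂ => χ (Additive.ofMul ρ) = -1) ×ˢ
        (Finset.univ.filter fun χ : AddChar (Additive G) ℂ => χ (Additive.ofMul ρ) = -1) ×ˢ
        (Finset.univ.filter fun χ : AddChar (Additive G) ℂ => χ (Additive.ofMul ρ) = -1)).filter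
      fun τ => τ.1 ≠ τ.2.1 ∧ τ.1 ≠ τ.2.2 ∧ τ.2.1 ≠ τ.2.2) ×ˢ (Finset.univ : Finset G))
    (t := ((Finset.univ : Finset (Finset G)).filter fun T : Finset G =>
      IsCMTypeWith ρ (T : Set G) ∧ typeRank G (T : Set G) = 5))
    (fun p hp => translate_mem_filter_typeRank_eq_five (ρ := ρ) hexp hp)
  rw [Finset.sum_congr rfl fun T hT => card_fibre_eq hexp (Finset.mem_filter.1 hT).2.1 (Finset.mem_filter.1 hT).2.2,
    Finset.sum_const, smul_eq_mul, Finset.card_product, Finset.card_univ, card_filter_triples_pairwise_ne] at hfib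
  have hm := two_mul_card_filter_odd_eq_rc hexp hρ1
  set m := (Finset.univ.filter fun χ : AddChar (Additive G) ℂ => χ (Additive.ofMul ρ) = -1).card with hm_def
  have hG : 0 < Fintype.card G := Fintype.card_pos
  have h3 : m * (m - 1) * (m - 2) = 3 * ((Finset.univ : Finset (Finset G)).filter fun T : Finset G =>
      IsCMTypeWith ρ (T : Set G) ∧ typeRank G (T : Set G) = 5).card := by
    have : m * (m - 1) * (m - 2) * Fintype.card G =
        (3 * ((Finset.univ : Finset (Finset G)).filter fun T : Finset G =>
      IsCMTypeWith ρ (T : Set G) ∧ typeRank G (T : Set G) = 5).card) * Fintype.card G := by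
      rw [hfib]; ring
    exact Nat.eq_of_mul_eq_mul_right hG this
  have hdesc : m * (m - 1) * (m - 2) = 6 * m.choose 3 := by
    rw [show m * (m - 1) * (m - 2) = m.descFactorial 3 by
      simp only [Nat.descFactorial_succ, Nat.descFactorial_zero, Nat.sub_zero, mul_one]; ring,
      Nat.descFactorial_eq_factorial_mul_choose]
    rfl
  have hm2 : Fintype.card G / 2 = m := by omega
  rw [hm2]
  omega

/-- **On `(ℤ/2)^{n+1}`: `2·C(2ⁿ, 3)` CM types of rank `5`.** [cite: Kubota1965, §4 Lemma 2]
[cite: Dodson1984, §3.1.1 Theorem] -/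
theorem card_filter_typeRank_eq_five_of_card_eq_two_pow (hexp : ∀ g : G, g ^ 2 = 1) (hρ1 : ρ ≠ 1) {n : ℕ}
    (hcard : Fintype.card G = 2 ^ (n + 1)) :
    ((Finset.univ : Finset (Finset G)).filter fun T : Finset G =>
      IsCMTypeWith ρ (T : Set G) ∧ typeRank G (T : Set G) = 5).card =
      2 * Nat.choose (2 ^ n) 3 := by
  rw [card_filter_typeRank_eq_five hexp hρ1, hcard, pow_succ, Nat.mul_div_cancel _ two_pos]

/-- **Order `8`: exactly `8` CM types of rank `5`** (the nondegenerate types of `(ℤ/2)³`; `8 = 2·C(4,3)`).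
[cite: Kubota1965, §4 Lemma 2] -/
theorem card_filter_typeRank_eq_five_of_card_eq_eight (hexp : ∀ g : G, g ^ 2 = 1) (hρ1 : ρ ≠ 1)
    (hcard : Fintype.card G = 8) :
    ((Finset.univ : Finset (Finset G)).filter fun T : Finset G =>
      IsCMTypeWith ρ (T : Set G) ∧ typeRank G (T : Set G) = 5).card = 8 := by
  rw [card_filter_typeRank_eq_five hexp hρ1, hcard]; decide

/-- **Order `16`: exactly `112` CM types of rank `5`** (`= 2·C(8,3)`; degree-`16` multiquadratic CM fields).
[cite: Kubota1965, §4 Lemma 2] -/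
theorem card_filter_typeRank_eq_five_of_card_eq_sixteen (hexp : ∀ g : G, g ^ 2 = 1) (hρ1 : ρ ≠ 1)
    (hcard : Fintype.card G = 16) :
    ((Finset.univ : Finset (Finset G)).filter fun T : Finset G =>
      IsCMTypeWith ρ (T : Set G) ∧ typeRank G (T : Set G) = 5).card = 112 := by
  rw [card_filter_typeRank_eq_five hexp hρ1, hcard]; decide

/-- **Order `32`: exactly `1120` CM types of rank `5`** (`= 2·C(16,3)`; degree-`32` multiquadratic CM fields).
[cite: Kubota1965, §4 Lemma 2] -/
theorem card_filter_typeRank_eq_five_of_card_eq_thirtyTwo (hexp : ∀ g : G, g ^ 2 = 1) (hρ1 : ρ ≠ 1)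
    (hcard : Fintype.card G = 32) :
    ((Finset.univ : Finset (Finset G)).filter fun T : Finset G =>
      IsCMTypeWith ρ (T : Set G) ∧ typeRank G (T : Set G) = 5).card = 1120 := by
  rw [card_filter_typeRank_eq_five hexp hρ1, hcard]; decide

end Census

end ExponentTwo

end CyclicCMType

end Literature.NumberTheory.ComplexMultiplication
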